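import Literature.AlgebraicGeometry.Resolution.WeightedResolutionDatum
import HarnessLib

/-!
# Support-first pre-data: the weighted resolution datum with `(ii)` built in and `(iv)` only on the
# exceptional divisor

Topic: `Literature/AlgebraicGeometry/Resolution`. A reduction of the interface
`WeightedResolutionDatum p` (this directory, `WeightedResolutionDatum.lean`; the interface posited by
route `ResolutionOfSingularities/WeightedInvariant`, crux `WeightedConstruction`, stmt-0571) to the part of
it that carries mathematical content, isolated by the line `support-first-weights-second` of that crux
(tree: `Summits/ResolutionOfSingularities/ResolutionOfSingularities/Cruxes/WeightedConstruction/Lines/`).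

A **support-first pre-datum in characteristic `p`** (`SupportFirstPreDatum p`) consists of ONE
well-ordered value type `Γ`, a rating `rate f X y : Γ` of pointed pairs `(Y ⊇ X ∋ y)` that is only ever
read at the SINGULAR points of `X` (`IsSingularPt X y`: some point of Mathlib's `X.subscheme` over `y`
has a non-regular local ring), and a weighted centre `centre f X : ReesAlgebraData Y`, subject to:
upper semicontinuity of the rating ON THE SINGULAR LOCUS (superlevel sets are traces of closed sets),
functoriality of the rating at singular points for smooth `k`-morphisms and perfect ground-field
extensions, and — when `X` has a singular point — a regular weighted centre supported exactly on the
singular points of maximal rating ("support first"), functorial for smooth surjections and perfect base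
change, whose cobordant blow-up makes the rating DROP at every point of the EXCEPTIONAL divisor of every
affine cobordant chart `B₊(U)` at which the strict transform is singular ("weights second"), the latter
stated under the hypotheses that `B₊(U) → Spec k` is smooth, separated and quasi-compact.

Compared with `WeightedResolutionDatum p`: axiom `(ii)` (`inv` minimal exactly at the regular-or-absent
points) is no longer an axiom but is BUILT INTO the invariant `SupportFirstPreDatum.inv := ⊥` at the
regular points and `↑rate` at the singular ones (values in `WithBot Γ`); axiom `(iv)` is demanded only
ON the exceptional divisor (off it, the chart `B₊(U) ∖ V(t⁻¹) = (U ∖ supp) × 𝔾ₘ` is smooth over `Y` and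
the strict transform is the pull-back of `X`, so any smooth-functorial rating is unchanged there —
Włodarczyk, arXiv:2203.03090, Thm. 1.1.2 (4) "`X' ∖ D' ≃ (X ∖ V(𝒥)) × T`" and §3.3.33); and the
smoothness of `B₊(U)` (ibid. 2.3.9) is a hypothesis of the drop axiom, not something the constructor
must prove. That a pre-datum yields a datum is proved on the summit side
(`Summits/ResolutionOfSingularities/ResolutionOfSingularities/Theorems/WeightedInvariantWeightedConstructionOfPreDatum.lean`,
`SupportFirstPreDatum.toDatum`), from the landed scheme-theoretic facts: closedness and smooth /
perfect-base-change invariance of the singular locus, regularity of the full cobordant blow-up of a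
regular weighted centre over an arbitrary affine chart, smoothness / separatedness / quasi-compactness of
`B₊(U)`, and the off-exceptional comparison. Conversely every datum restricts to a pre-datum (`rate :=
inv`), so `Nonempty (SupportFirstPreDatum p) ↔ Nonempty (WeightedResolutionDatum p)`; the forward
direction is the useful one: it is the exact residual content of the crux.

This file: the predicate `IsSingularPt`, the structure, the invariant `SupportFirstPreDatum.inv` and its
elementary API (`inv_of_isSingularPt`, `inv_of_not_isSingularPt`, `isBot_inv_iff_not_isSingularPt`,
`guard_iff`, `coe_le_inv_iff`, `isMax_inv_iff`). EVIDENCE-type structure, not a claim; no new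
mathematics is asserted.

## Sources

* J. Włodarczyk, *Functorial resolution by torus actions*, arXiv:2203.03090: Thm. 1.1.2 (4), Def. 2.3.5,
  2.3.9, §3.3.33, Thm. 4.3.1. [Wlodarczyk2022]
* D. Abramovich, M. Temkin, J. Włodarczyk, *Functorial embedded resolution via weighted blowings up*,
  Algebra Number Theory 18 (2024), Thm. 1.1.1, §1.9. [AbramovichTemkinWlodarczyk2024]
-/

noncomputable section

open CategoryTheory CategoryTheory.Limits AlgebraicGeometry TopologicalSpace

namespace Literature.AlgebraicGeometry.Resolution

/-- `X` is **singular at the point `y`** of the ambient scheme `Y`: some point of the closed subscheme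
`X.subscheme` (Mathlib) lying over `y` has a non-regular local ring. This is the negation of the
right-hand side of axiom `(ii)` of `WeightedResolutionDatum` (`isBot_inv_iff`); off the support of `X`
it is false, and on it it says that the unique point of `X.subscheme` over `y` is a singular point.
[folklore] -/
def IsSingularPt {Y : Scheme.{0}} (X : Y.IdealSheafData) (y : Y) : Prop :=
  ∃ x : X.subscheme, X.subschemeι x = y ∧ ¬ IsRegularLocalRing (X.subscheme.presheaf.stalk x)

/-- **Support-first pre-datum in characteristic `p`**: a rating `rate` of the pointed pairs
`(Y ⊇ X ∋ y)` with values in ONE well-ordered type `Γ`, meaningful at the SINGULAR points of `X`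
(`IsSingularPt X y`), together with a weighted centre, such that (for `k` perfect of characteristic `p`,
`f : Y → Spec k` smooth separated quasi-compact): the rating is upper semicontinuous on the singular
locus (`isClosed_superlevel`: superlevel sets are traces of closed sets), functorial for smooth
`k`-morphisms and perfect ground-field extensions at singular points; when `X` has a singular point the
centre is a regular weighted centre supported exactly on the singular points of maximal rating (SUPPORT
FIRST), functorial for smooth surjections and perfect base change; and (WEIGHTS SECOND, the positional
drop) at every point `b` of the EXCEPTIONAL divisor `V(t⁻¹)` of every affine cobordant chart `B₊(U)` at
which the strict transform is singular, the rating is strictly below the maximal rating downstairs —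
stated under the hypotheses that `B₊(U) → Spec k` is smooth, separated and quasi-compact. The shape is
that of `WeightedResolutionDatum` (Abramovich–Temkin–Włodarczyk 2024, Thm. 1.1.1; Włodarczyk
arXiv:2203.03090, Thms. 1.1.2 (4), 4.3.1, §3.3.33) with axiom `(ii)` built in and `(iv)` restricted to
the exceptional divisor. EVIDENCE, not a claim.
[cite: Wlodarczyk2022, Thm. 1.1.2 (4), §3.3.33 and Thm. 4.3.1] -/
structure SupportFirstPreDatum (p : ℕ) : Type 1 where
  /-- the value set of the rating (one for all dimensions) -/
  Γ : Type
  /-- `Γ` is linearly ordered … -/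
  [linearOrder : LinearOrder Γ]
  /-- … and well-ordered -/
  [wellFoundedLT : WellFoundedLT Γ]
  /-- the rating of a pointed pair (total; meaningful at singular points of `X`, `k` perfect of char `p`,
  `f` smooth separated quasi-compact) -/
  rate : ∀ ⦃k : Type⦄ [Field k] ⦃Y : Scheme.{0}⦄, (Y ⟶ Spec (.of k)) → Y.IdealSheafData → Y → Γ
  /-- the weighted centre of `(Y, X)` -/
  centre : ∀ ⦃k : Type⦄ [Field k] ⦃Y : Scheme.{0}⦄, (Y ⟶ Spec (.of k)) → Y.IdealSheafData →
    ReesAlgebraData Y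
  /-- usc ON THE SINGULAR LOCUS: every superlevel set of `rate` is the trace of a closed subset of `Y` -/
  isClosed_superlevel : ∀ ⦃k : Type⦄ [Field k] [CharP k p] [PerfectField k] ⦃Y : Scheme.{0}⦄
    (f : Y ⟶ Spec (.of k)) [Smooth f] [IsSeparated f] [QuasiCompact f] (X : Y.IdealSheafData)
    (γ : Γ), ∃ C : Set Y, IsClosed C ∧ ∀ y : Y, IsSingularPt X y → (y ∈ C ↔ γ ≤ rate f X y)
  /-- functoriality of `rate` for smooth `k`-morphisms, at singular points -/
  rate_comap : ∀ ⦃k : Type⦄ [Field k] [CharP k p] [PerfectField k] ⦃Y Y₁ : Scheme.{0}⦄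
    (f : Y ⟶ Spec (.of k)) [Smooth f] [IsSeparated f] [QuasiCompact f]
    (f₁ : Y₁ ⟶ Spec (.of k)) [Smooth f₁] [IsSeparated f₁] [QuasiCompact f₁]
    (g : Y₁ ⟶ Y) [Smooth g], g ≫ f = f₁ →
    ∀ (X : Y.IdealSheafData) (y₁ : Y₁), IsSingularPt X (g y₁) →
      rate f₁ (X.comap g) y₁ = rate f X (g y₁)
  /-- functoriality of `rate` for extensions of perfect ground fields, at singular points -/
  rate_baseChange : ∀ ⦃k : Type⦄ [Field k] [CharP k p] [PerfectField k]
    ⦃K : Type⦄ [Field K] [PerfectField K] (φ : k →+* K)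
    ⦃Y YK : Scheme.{0}⦄ (f : Y ⟶ Spec (.of k)) [Smooth f] [IsSeparated f] [QuasiCompact f]
    (fK : YK ⟶ Spec (.of K)) (pr : YK ⟶ Y),
    IsPullback pr fK f (Spec.map (CommRingCat.ofHom φ)) →
    ∀ (X : Y.IdealSheafData) (y : YK), IsSingularPt X (pr y) →
      rate fK (X.comap pr) y = rate f X (pr y)
  /-- SUPPORT FIRST, regularity: when `X` has a singular point the centre is a regular weighted centre … -/
  isRegularWeightedCentre_centre : ∀ ⦃k : Type⦄ [Field k] [CharP k p] [PerfectField k]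
    ⦃Y : Scheme.{0}⦄ (f : Y ⟶ Spec (.of k)) [Smooth f] [IsSeparated f] [QuasiCompact f]
    (X : Y.IdealSheafData), (∃ y : Y, IsSingularPt X y) → (centre f X).IsRegularWeightedCentre
  /-- … supported exactly on the singular points of maximal rating -/
  support_centre : ∀ ⦃k : Type⦄ [Field k] [CharP k p] [PerfectField k]
    ⦃Y : Scheme.{0}⦄ (f : Y ⟶ Spec (.of k)) [Smooth f] [IsSeparated f] [QuasiCompact f]
    (X : Y.IdealSheafData), (∃ y : Y, IsSingularPt X y) →
    (centre f X).support =
      {y : Y | IsSingularPt X y ∧ ∀ y' : Y, IsSingularPt X y' → rate f X y' ≤ rate f X y}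
  /-- functoriality of the centre for smooth SURJECTIVE `k`-morphisms -/
  centre_comap : ∀ ⦃k : Type⦄ [Field k] [CharP k p] [PerfectField k] ⦃Y Y₁ : Scheme.{0}⦄
    (f : Y ⟶ Spec (.of k)) [Smooth f] [IsSeparated f] [QuasiCompact f]
    (f₁ : Y₁ ⟶ Spec (.of k)) [Smooth f₁] [IsSeparated f₁] [QuasiCompact f₁]
    (g : Y₁ ⟶ Y) [Smooth g] [Surjective g], g ≫ f = f₁ →
    ∀ (X : Y.IdealSheafData), (∃ y : Y, IsSingularPt X y) →
    ∀ n : ℕ, (centre f₁ (X.comap g)).piece n = ((centre f X).piece n).comap g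
  /-- functoriality of the centre for extensions of perfect ground fields -/
  centre_baseChange : ∀ ⦃k : Type⦄ [Field k] [CharP k p] [PerfectField k]
    ⦃K : Type⦄ [Field K] [PerfectField K] (φ : k →+* K)
    ⦃Y YK : Scheme.{0}⦄ (f : Y ⟶ Spec (.of k)) [Smooth f] [IsSeparated f] [QuasiCompact f]
    (fK : YK ⟶ Spec (.of K)) (pr : YK ⟶ Y),
    IsPullback pr fK f (Spec.map (CommRingCat.ofHom φ)) →
    ∀ (X : Y.IdealSheafData), (∃ y : Y, IsSingularPt X y) →
    ∀ n : ℕ, (centre fK (X.comap pr)).piece n = ((centre f X).piece n).comap pr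
  /-- WEIGHTS SECOND, the positional drop at the EXCEPTIONAL points of the cobordant blow-up: on every
  affine chart `U`, granted that `B₊(U) → Spec k` is smooth separated quasi-compact, at every point `b` of
  `B₊(U)` lying on the exceptional divisor `V(t⁻¹)` at which the strict transform of `X` is singular, the
  rating is strictly below the rating at any singular point `y` of maximal rating downstairs -/
  rate_exceptional_lt : ∀ ⦃k : Type⦄ [Field k] [CharP k p] [PerfectField k]
    ⦃Y : Scheme.{0}⦄ (f : Y ⟶ Spec (.of k)) [Smooth f] [IsSeparated f] [QuasiCompact f]
    (X : Y.IdealSheafData), (∃ y : Y, IsSingularPt X y) →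
    ∀ (U : Y.affineOpens), Smooth ((centre f X).cobordantPlusι U ≫ f) →
      IsSeparated ((centre f X).cobordantPlusι U ≫ f) →
      QuasiCompact ((centre f X).cobordantPlusι U ≫ f) →
    ∀ (b : (centre f X).cobordantPlus U) (y : Y), IsSingularPt X y →
      (∀ y' : Y, IsSingularPt X y' → rate f X y' ≤ rate f X y) →
      (affineCobordantBlowup.plusOpens ((centre f X).chartIdeals U)).ι b ∈
        ((affineCobordantBlowup.exceptional ((centre f X).chartIdeals U)).support :
          Set (affineCobordantBlowup ((centre f X).chartIdeals U))) →
      IsSingularPt ((centre f X).cobordantStrictTransform U X) b →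
      rate ((centre f X).cobordantPlusι U ≫ f) ((centre f X).cobordantStrictTransform U X) b
        < rate f X y

namespace SupportFirstPreDatum

variable {p : ℕ} (D : SupportFirstPreDatum p)

/-- The value set of a pre-datum is linearly ordered (structure field as an instance). [folklore] -/
instance instLinearOrder : LinearOrder D.Γ := D.linearOrder

/-- The value set of a pre-datum is well-ordered (structure field as an instance). [folklore] -/
instance instWellFoundedLT : WellFoundedLT D.Γ := D.wellFoundedLT

open Classical in
/-- The invariant of the datum built from a pre-datum: `⊥` at the points where `X` is regular or absent,
the rating (in `WithBot Γ`) at the singular points — axiom `(ii)` of `WeightedResolutionDatum` holds by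
construction (`isBot_inv_iff_not_isSingularPt`). [folklore] -/
def inv ⦃k : Type⦄ [Field k] ⦃Y : Scheme.{0}⦄ (f : Y ⟶ Spec (.of k)) (X : Y.IdealSheafData) (y : Y) :
    WithBot D.Γ :=
  if IsSingularPt X y then (D.rate f X y : WithBot D.Γ) else ⊥

variable {k : Type} [Field k] {Y : Scheme.{0}} (f : Y ⟶ Spec (.of k)) (X : Y.IdealSheafData)

/-- At a singular point the invariant is the rating. [folklore] -/
theorem inv_of_isSingularPt {y : Y} (h : IsSingularPt X y) : D.inv f X y = D.rate f X y := by
  simp [inv, h]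

/-- At a regular (or absent) point the invariant is `⊥`. [folklore] -/
theorem inv_of_not_isSingularPt {y : Y} (h : ¬ IsSingularPt X y) : D.inv f X y = ⊥ := by
  simp [inv, h]

/-- The invariant is minimal exactly at the non-singular points (axiom `(ii)`). [folklore] -/
theorem isBot_inv_iff_not_isSingularPt (y : Y) : IsBot (D.inv f X y) ↔ ¬ IsSingularPt X y := by
  constructor
  · intro hbot hsing
    rw [D.inv_of_isSingularPt f X hsing] at hbot
    exact WithBot.coe_ne_bot (le_bot_iff.mp (hbot ⊥))
  · intro h
    rw [D.inv_of_not_isSingularPt f X h]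
    exact isBot_bot

/-- The guard of the datum (`inv` not everywhere minimal) is the existence of a singular point.
[folklore] -/
theorem guard_iff : (∃ y : Y, ¬ IsBot (D.inv f X y)) ↔ ∃ y : Y, IsSingularPt X y := by
  simp only [D.isBot_inv_iff_not_isSingularPt f X, not_not]

/-- A superlevel set of the invariant at a non-bottom level is the corresponding superlevel set of the
rating inside the singular locus. [folklore] -/
theorem coe_le_inv_iff (γ : D.Γ) (y : Y) :
    (γ : WithBot D.Γ) ≤ D.inv f X y ↔ IsSingularPt X y ∧ γ ≤ D.rate f X y := by
  by_cases h : IsSingularPt X y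
  · rw [D.inv_of_isSingularPt f X h, WithBot.coe_le_coe]
    exact ⟨fun hle => ⟨h, hle⟩, fun hh => hh.2⟩
  · rw [D.inv_of_not_isSingularPt f X h]
    simp only [h, false_and, iff_false]
    exact fun hle => WithBot.coe_ne_bot (le_bot_iff.mp hle)

/-- The maximum locus of the invariant, when a singular point exists, is the set of singular points of
maximal rating. [folklore] -/
theorem isMax_inv_iff (hG : ∃ y : Y, IsSingularPt X y) (y : Y) :
    (∀ y' : Y, D.inv f X y' ≤ D.inv f X y) ↔
      IsSingularPt X y ∧ ∀ y' : Y, IsSingularPt X y' → D.rate f X y' ≤ D.rate f X y := by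
  obtain ⟨y₀, hy₀⟩ := hG
  constructor
  · intro h
    have hy : IsSingularPt X y := by
      by_contra hy
      have := h y₀
      rw [D.inv_of_isSingularPt f X hy₀, D.inv_of_not_isSingularPt f X hy] at this
      exact WithBot.coe_ne_bot (le_bot_iff.mp this)
    refine ⟨hy, fun y' hy' => ?_⟩
    have := h y'
    rwa [D.inv_of_isSingularPt f X hy', D.inv_of_isSingularPt f X hy, WithBot.coe_le_coe] at this
  · rintro ⟨hy, h⟩ y'
    by_cases hy' : IsSingularPt X y'
    · rw [D.inv_of_isSingularPt f X hy', D.inv_of_isSingularPt f X hy, WithBot.coe_le_coe]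
      exact h y' hy'
    · rw [D.inv_of_not_isSingularPt f X hy']
      exact bot_le

/-- The guard of a datum from a singular point: a singular point is a point where `inv` is not minimal.
[folklore] -/
theorem _root_.Literature.AlgebraicGeometry.Resolution.WeightedResolutionDatum.not_isBot_inv_iff_isSingularPt
    (E : WeightedResolutionDatum p) [CharP k p] [PerfectField k] [Smooth f] [IsSeparated f]
    [QuasiCompact f] (y : Y) : ¬ IsBot (E.inv f X y) ↔ IsSingularPt X y := by
  rw [E.isBot_inv_iff f X y, IsSingularPt]
  push Not
  rfl

/-- **Every datum restricts to a pre-datum** (`rate := inv`, same centre): the trivial direction of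
`Nonempty (SupportFirstPreDatum p) ↔ Nonempty (WeightedResolutionDatum p)`. [folklore] -/
def ofDatum (E : WeightedResolutionDatum p) : SupportFirstPreDatum p where
  Γ := E.Γ
  rate := E.inv
  centre := E.centre
  isClosed_superlevel := by
    intro k _ _ _ Y f _ _ _ X γ
    exact ⟨{y | γ ≤ E.inv f X y}, E.isClosed_superlevel f X γ, fun _ _ => Iff.rfl⟩
  rate_comap := by
    intro k _ _ _ Y Y₁ f _ _ _ f₁ _ _ _ g _ hg X y₁ _
    exact E.inv_comap f f₁ g hg X y₁
  rate_baseChange := by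
    intro k _ _ _ K _ _ φ Y YK f _ _ _ fK pr hpb X y _
    exact E.inv_baseChange φ f fK pr hpb X y
  isRegularWeightedCentre_centre := by
    intro k _ _ _ Y f _ _ _ X hG
    obtain ⟨y, hy⟩ := hG
    exact E.isRegularWeightedCentre_centre f X ⟨y, (E.not_isBot_inv_iff_isSingularPt f X y).mpr hy⟩
  support_centre := by
    intro k _ _ _ Y f _ _ _ X hG
    obtain ⟨y₀, hy₀⟩ := hG
    have hG' : ∃ y : Y, ¬ IsBot (E.inv f X y) := ⟨y₀, (E.not_isBot_inv_iff_isSingularPt f X y₀).mpr hy₀⟩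
    rw [E.support_centre f X hG']
    ext y
    simp only [Set.mem_setOf_eq]
    constructor
    · intro h
      exact ⟨(E.not_isBot_inv_iff_isSingularPt f X y).mp (E.not_isBot_of_isMaxOn f X hG' h),
        fun y' _ => h y'⟩
    · rintro ⟨-, h⟩ y'
      by_cases hy' : IsBot (E.inv f X y')
      · exact hy' _
      · exact h y' ((E.not_isBot_inv_iff_isSingularPt f X y').mp hy')
  centre_comap := by
    intro k _ _ _ Y Y₁ f _ _ _ f₁ _ _ _ g _ _ hg X hG n
    obtain ⟨y, hy⟩ := hG
    exact E.centre_comap f f₁ g hg X ⟨y, (E.not_isBot_inv_iff_isSingularPt f X y).mpr hy⟩ n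
  centre_baseChange := by
    intro k _ _ _ K _ _ φ Y YK f _ _ _ fK pr hpb X hG n
    obtain ⟨y, hy⟩ := hG
    exact E.centre_baseChange φ f fK pr hpb X ⟨y, (E.not_isBot_inv_iff_isSingularPt f X y).mpr hy⟩ n
  rate_exceptional_lt := by
    intro k _ _ _ Y f _ _ _ X hG U _ _ _ b y _ hymax _ _
    obtain ⟨y₀, hy₀⟩ := hG
    have hG' : ∃ y : Y, ¬ IsBot (E.inv f X y) := ⟨y₀, (E.not_isBot_inv_iff_isSingularPt f X y₀).mpr hy₀⟩
    refine E.inv_cobordantPlus_lt f X hG' U b y fun y' => ?_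
    by_cases hy' : IsBot (E.inv f X y')
    · exact hy' _
    · exact hymax y' ((E.not_isBot_inv_iff_isSingularPt f X y').mp hy')

end SupportFirstPreDatum

end Literature.AlgebraicGeometry.Resolution

end
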